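/-
Copyright (c) 2026 the pub-hodgecm-mathlib formalisation cell (harness21).  Prover seat hodgecm-mathlib-K2E3-p27 (g2), R90-TF SLAB section S3
(Rogawski Ch. 12 endoscopic character identities), hand p08 «FINITE LENGTH OF THE PRINCIPAL SERIES» (a) of the S3 dealer R90-C12-plan (g0), R90 bus
2026-09-04T16:16:30Z; h413 = `stmt-HodgeConjecture-24833`.
-/
import Mathlib.RingTheory.FiniteLength
import Mathlib.RepresentationTheory.Subrepresentation
import HarnessLib

/-!
# R90 · S3 · p08 (a) — a module with no chain `⊥ < N₁ < N₂ < ⊤` of submodules has FINITE LENGTH; the representation form over the monoid algebra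

Cell `pub/hodgecm-mathlib`, crux H413 = `stmt-HodgeConjecture-24833`, route of record `HCCMUnconditional`; R90-TF SLAB section S3 (dealer R90-C12-plan (g0); chair
K2-lead (g2)), hand p08 (a) = the PURE MODULE ALGEBRA half of «finite length of the principal series» (the (b) half, the `U(3)`∕`U(2)`∕`H` instances, is the sibling
`Theorems/R90S3PrincipalSeriesFiniteLength.lean`).  THEOREMS ONLY (Mathlib imports only; no definition, no instance, no notation, no named-fact hypothesis, no `sorry`);
lane `--kind proof --supports stmt-HodgeConjecture-24833 --as helper`; namespace `Summit.HodgeConjecture.HodgeConjecture.R90.S3`.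

WHY.  FILE E's printed socket `stub_R90_S3_print_492` (Rogawski L. 4.9.2 signed) carries, on p03's discharge road (★ p861751 `R90.S3.endoExpansion_exists_of_indPS`, hypothesis
`h492`), the conjunct «`IsFiniteLength (MonoidAlgebra ℂ G_v) I.asModule`» for the principal series `I = i_G(χ̃)` — print uses «`i_G(χ)` has at most two constituents»
([Rogawski1990, §12.2 p. 173], [Casselman1995, Cor. 7.1.2]) where Mathlib wants `IsFiniteLength`.  The tree proves the two-constituent bound in the shape «no chain
`⊥ < N₁ < N₂ < ⊤` of subrepresentations» (★ `K2E3U3PrincipalSeriesJHStructure.not_bot_lt_lt_lt_top_cmPrincipalSeries_three`, ★ D121 `…_cmPrincipalSeries_two`); this file is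
the bridge «no such chain ⇒ finite length», which `rg` does not find in Mathlib or in `Literature/Algebra/Module` under any name (census 2026-09-04T16:25Z:
`isFiniteLength_iff_isNoetherian_isArtinian`, `isFiniteLength_of_finite_of_isArtinianRing`, `isFiniteLength_of_finiteDimensional`, … — none from a chain bound).

CONTENTS.
* §1 `forall_not_bot_lt_lt_lt_top_of_orderIso` — the hypothesis transports along an order isomorphism of bounded orders (used at ★
  `Subrepresentation.subrepresentationSubmoduleOrderIso` and at ★ `subrepresentationCMPrincipalSeriesHOrderIso`); `not_lt_lt_lt_of_forall_not_bot_lt_lt_lt_top`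
  (no strict 4-chain `a < b < c < d` at all: `⊥ ≤ a < b`, `c < d ≤ ⊤`).
* §2 **`isFiniteLength_of_forall_not_bot_lt_lt_lt_top`**: for a module `M` over a ring `R`, `(∀ N₁ N₂, ¬ (⊥ < N₁ ∧ N₁ < N₂ ∧ N₂ < ⊤)) → IsFiniteLength R M` — a strictly
  monotone (either way) sequence `ℕ → Submodule R M` would contain a strict 4-chain, so `Submodule R M` is well-founded for `>` and for `<` (Mathlib
  `RelEmbedding.wellFounded_iff_isEmpty`), i.e. `M` is Noetherian and Artinian (`isNoetherian_iff`, `isArtinian_iff`), i.e. of finite length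
  (`isFiniteLength_iff_isNoetherian_isArtinian`).
* §3 **`isFiniteLength_asModule_of_forall_not_bot_lt_lt_lt_top`**: for a representation `ρ` of a monoid `G` on a `k`-module `W` (`k` a commutative ring), the same hypothesis on
  `Subrepresentation ρ` (Mathlib) gives `IsFiniteLength (MonoidAlgebra k G) ρ.asModule`, through Mathlib's order isomorphism
  `Subrepresentation ρ ≃o Submodule k[G] ρ.asModule`.

HONEST LABEL.  Count-neutral helper (generic algebra; closes no socket); HC_CM is proved only modulo the 7 printed citations (2 remaining named inputs: hLiu418 =
`stmt-HodgeConjecture-24832`, h413 = `stmt-HodgeConjecture-24833`) until rung 0 closes; REL ≠ ★ ≠ BUILT.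

## References
* [Casselman1995] W. Casselman, *Introduction to the theory of admissible representations of 𝔭-adic reductive groups* (1995), Cor. 7.1.2 p. 67 (length of the principal
  series), §2.1 (admissible representations of finite length).
* [BernsteinZelevinsky1977] I. N. Bernstein, A. V. Zelevinsky, *Induced representations of reductive 𝔭-adic groups I*, Ann. Sci. ÉNS 10 (1977), Thm. 2.8, §2.12.
* [Rogawski1990] J. D. Rogawski, *Automorphic Representations of Unitary Groups in Three Variables*, Ann. of Math. Stud. 123 (1990), §12.2 p. 173 («`i_G(χ)` … contains exactly
  two irreducible constituents ([BZ])»), §4.9 L. 4.9.2 p. 55.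
* [AndersonFuller1992] F. W. Anderson, K. R. Fuller, *Rings and Categories of Modules*, 2nd ed., GTM 13 (1992), §11 Prop. 11.1 (finite length ⟺ ACC + DCC; composition
  length bounds chain length).
-/

set_option autoImplicit false
-- the mandated namespace repeats `HodgeConjecture.HodgeConjecture`, as in every `Theorems/*.lean` of this sub-problem
set_option linter.dupNamespace false

namespace Summit.HodgeConjecture.HodgeConjecture.R90.S3

/-! ## §1 The chain hypothesis: transport along order isomorphisms; no strict 4-chains -/

section Order

variable {α β : Type*} [PartialOrder α] [PartialOrder β] [BoundedOrder α] [BoundedOrder β]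

/-- **«no chain `⊥ < a < b < ⊤`» transports along an order isomorphism** of bounded partial orders (`e ⊥ = ⊥`, `e ⊤ = ⊤`, `e` reflects `<`).
[cite: AndersonFuller1992, §11 Prop. 11.1] -/
theorem forall_not_bot_lt_lt_lt_top_of_orderIso (e : α ≃o β) (h : ∀ a b : β, ¬ (⊥ < a ∧ a < b ∧ b < ⊤)) :
    ∀ a b : α, ¬ (⊥ < a ∧ a < b ∧ b < ⊤) := by
  rintro a b ⟨h₁, h₂, h₃⟩
  refine h (e a) (e b) ⟨?_, e.lt_iff_lt.2 h₂, ?_⟩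
  · rw [← e.map_bot]
    exact e.lt_iff_lt.2 h₁
  · rw [← e.map_top]
    exact e.lt_iff_lt.2 h₃

/-- Under «no chain `⊥ < a < b < ⊤`» there is NO strict chain `a < b < c < d` at all (`⊥ ≤ a < b` and `c < d ≤ ⊤` give `⊥ < b < c < ⊤`).
[cite: AndersonFuller1992, §11 Prop. 11.1] -/
theorem not_lt_lt_lt_of_forall_not_bot_lt_lt_lt_top (h : ∀ a b : α, ¬ (⊥ < a ∧ a < b ∧ b < ⊤)) {a b c d : α}
    (hab : a < b) (hbc : b < c) (hcd : c < d) : False :=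
  h b c ⟨lt_of_le_of_lt bot_le hab, hbc, lt_of_lt_of_le hcd le_top⟩

end Order

/-! ## §2 Modules: no chain `⊥ < N₁ < N₂ < ⊤` of submodules ⇒ finite length -/

section Module

variable {R M : Type*} [Ring R] [AddCommGroup M] [Module R M]

/-- **A module with no chain `⊥ < N₁ < N₂ < ⊤` of submodules HAS FINITE LENGTH** (indeed length `≤ 2`): by §1 `Submodule R M` has no strict 4-chain, so it admits no
strictly increasing and no strictly decreasing sequence `ℕ → Submodule R M` (Mathlib `RelEmbedding.wellFounded_iff_isEmpty`), i.e. `M` is Noetherian (`isNoetherian_iff`)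
and Artinian (`isArtinian_iff`), i.e. of finite length (`isFiniteLength_iff_isNoetherian_isArtinian`).  This is the bridge between print's «at most two constituents» for
`i_G(χ)` and the `IsFiniteLength` clause of the §4.9 character-identity road. [cite: AndersonFuller1992, §11 Prop. 11.1] [cite: Casselman1995, Cor. 7.1.2 p. 67] -/
theorem isFiniteLength_of_forall_not_bot_lt_lt_lt_top (h : ∀ N₁ N₂ : Submodule R M, ¬ (⊥ < N₁ ∧ N₁ < N₂ ∧ N₂ < ⊤)) : IsFiniteLength R M := by
  rw [isFiniteLength_iff_isNoetherian_isArtinian, isNoetherian_iff, isArtinian_iff, RelEmbedding.wellFounded_iff_isEmpty,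
    RelEmbedding.wellFounded_iff_isEmpty]
  refine ⟨⟨fun f => ?_⟩, ⟨fun f => ?_⟩⟩
  · -- `f` strictly increasing: `f 0 < f 1 < f 2 < f 3`
    exact not_lt_lt_lt_of_forall_not_bot_lt_lt_lt_top h (a := f 0) (b := f 1) (c := f 2) (d := f 3)
      (f.map_rel_iff.2 Nat.zero_lt_one) (f.map_rel_iff.2 Nat.one_lt_two) (f.map_rel_iff.2 (Nat.lt_succ_self 2))
  · -- `f` strictly decreasing: `f 3 < f 2 < f 1 < f 0`
    exact not_lt_lt_lt_of_forall_not_bot_lt_lt_lt_top h (a := f 3) (b := f 2) (c := f 1) (d := f 0)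
      (f.map_rel_iff.2 (Nat.lt_succ_self 2)) (f.map_rel_iff.2 Nat.one_lt_two) (f.map_rel_iff.2 Nat.zero_lt_one)

/-- The same with the hypothesis spelled as three separate arrows. [cite: AndersonFuller1992, §11 Prop. 11.1] -/
theorem isFiniteLength_of_forall_not_lt_lt_lt (h : ∀ N₁ N₂ : Submodule R M, ⊥ < N₁ → N₁ < N₂ → ¬ N₂ < ⊤) : IsFiniteLength R M :=
  isFiniteLength_of_forall_not_bot_lt_lt_lt_top fun N₁ N₂ hc => h N₁ N₂ hc.1 hc.2.1 hc.2.2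

end Module

/-! ## §3 Representations: no chain of subrepresentations ⇒ `ρ.asModule` has finite length over the monoid algebra -/

section Representation

variable {k G W : Type*} [CommRing k] [Monoid G] [AddCommGroup W] [Module k W] (ρ : Representation k G W)

/-- **No chain `⊥ < N₁ < N₂ < ⊤` of SUBREPRESENTATIONS ⇒ `ρ.asModule` has finite length over `k[G]`**: Mathlib's order isomorphism
`Subrepresentation.subrepresentationSubmoduleOrderIso : Subrepresentation ρ ≃o Submodule k[G] ρ.asModule` carries the hypothesis to submodules (§1), and §2 applies.
(The `G`-stable subspaces of `ρ` ARE the `k[G]`-submodules of `ρ.asModule`; «at most two constituents» ⇒ «finite length».) [cite: Casselman1995, Cor. 7.1.2 p. 67; §2.1]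
[cite: BernsteinZelevinsky1977, Thm. 2.8] -/
theorem isFiniteLength_asModule_of_forall_not_bot_lt_lt_lt_top (h : ∀ N₁ N₂ : Subrepresentation ρ, ¬ (⊥ < N₁ ∧ N₁ < N₂ ∧ N₂ < ⊤)) :
    IsFiniteLength (MonoidAlgebra k G) ρ.asModule :=
  isFiniteLength_of_forall_not_bot_lt_lt_lt_top
    (forall_not_bot_lt_lt_lt_top_of_orderIso (Subrepresentation.subrepresentationSubmoduleOrderIso (ρ := ρ)).symm h)

end Representation

end Summit.HodgeConjecture.HodgeConjecture.R90.S3
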